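import Summits.HubbardSuperconductivity.HubbardSuperconductivity.Theorems.AnisotropyChordTransferFibre3Hole2Quarter

/-!
# Route `AnisotropyChord` / H0 rotor rung: HOLE₂ per-`L` certificates — the `D₄`-COVERAGE of the representative separations, for every `L`

The per-`L` files close `TwoHoleGap L (3/4·eps1 L)` from kernel facts about the separations `repList L` = `{(x,y) : 0 ≤ y ≤ x ≤ L/2,
(x,y) ≠ 0}` (`…Fibre3Hole2Check`) and the fact that these meet the `D₄`-orbit (p1's `d4Orbit`, `…Fibre3TwoHoleGapReduce`) of every
nonzero separation.  For small `L` that coverage is a `decide`; its cost grows like `L⁴` and exceeds the kernel budget near `L ≈ 26`,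
so this file proves it ONCE FOR ALL `L` (`cover_repList`): fold each coordinate to `|valMinAbs| ≤ L/2` and order the pair — the eight
sign/swap images are exactly `d4Orbit`.  Consequence ★ `twoHoleGap_of_checkRepsQ_repList`: `checkRepsQ L (repList L) = true ⇒
TwoHoleGap L (3/4·eps1 L)` with NO coverage obligation left.
Prover seat `hubbard-h0-rotor-p3` g3; helper for stmt-HubbardSuperconductivity-19089 (`--supports`, helper class).
WHAT THIS IS NOT: nothing here proves superconductivity in the Hubbard model (rotor TARGET as worded stays FALSE, g15 verdict);
bookkeeping for the per-`L` HOLE₂ certificates of ONE conditional reduction (rung 19089). Tree imports only; no sorry.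
-/

set_option linter.dupNamespace false
set_option autoImplicit false

namespace Summit.HubbardSuperconductivity.HubbardSuperconductivity.Theorems.AnisotropyChord.Transfer.Fibre3

namespace Hole2

open Finset

/-- membership in `repList`: `y ≤ x ≤ L/2`, not both zero. [folklore] -/
theorem mem_repList {L x y : ℕ} (hx : x ≤ L / 2) (hy : y ≤ x) (h0 : ¬ (x = 0 ∧ y = 0)) : (x, y) ∈ repList L := by
  unfold repList
  rw [List.mem_filter, List.mem_flatMap]
  refine ⟨⟨x, List.mem_range.mpr (by omega), List.mem_map.mpr ⟨y, List.mem_range.mpr (by omega), rfl⟩⟩, ?_⟩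
  have : ¬ x = 0 ∨ ¬ y = 0 := by
    by_cases hx0 : x = 0
    · exact Or.inr (fun hy0 => h0 ⟨hx0, hy0⟩)
    · exact Or.inl hx0
  simpa using this

/-- a residue is `±` the cast of the absolute value of its centred representative. [folklore] -/
theorem natAbs_valMinAbs_cast {L : ℕ} [NeZero L] (a : ZMod L) :
    ((a.valMinAbs.natAbs : ℕ) : ZMod L) = a ∨ ((a.valMinAbs.natAbs : ℕ) : ZMod L) = -a := by
  rcases le_total 0 a.valMinAbs with h | h
  · left
    rw [← Int.cast_natCast, Int.natAbs_of_nonneg h, ZMod.coe_valMinAbs]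
  · right
    rw [← Int.cast_natCast, Int.ofNat_natAbs_of_nonpos h, Int.cast_neg, ZMod.coe_valMinAbs]

/-- ★ `D₄`-COVERAGE FOR EVERY `L`: each nonzero separation has an image `(x, y)`, `0 ≤ y ≤ x ≤ L/2`, in its `D₄`-orbit. [folklore] -/
theorem cover_repList (L : ℕ) [NeZero L] :
    ∀ z : Tor L, z ≠ 0 → ∃ s ∈ ((repList L).map fun ab => sT L ab.1 ab.2).toFinset, s ∈ d4Orbit L z := by
  intro z hz
  set x : ℕ := z.1.valMinAbs.natAbs with hxdef
  set y : ℕ := z.2.valMinAbs.natAbs with hydef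
  have hxL : x ≤ L / 2 := ZMod.natAbs_valMinAbs_le z.1
  have hyL : y ≤ L / 2 := ZMod.natAbs_valMinAbs_le z.2
  have h0 : ¬ (x = 0 ∧ y = 0) := by
    rintro ⟨hx0, hy0⟩
    apply hz
    have h1 : z.1 = 0 := by
      rw [← ZMod.valMinAbs_eq_zero]; exact Int.natAbs_eq_zero.mp hx0
    have h2 : z.2 = 0 := by
      rw [← ZMod.valMinAbs_eq_zero]; exact Int.natAbs_eq_zero.mp hy0
    exact Prod.ext h1 h2
  have hx := natAbs_valMinAbs_cast z.1
  have hy := natAbs_valMinAbs_cast z.2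
  rw [← hxdef] at hx
  rw [← hydef] at hy
  rcases le_total y x with hyx | hxy
  · refine ⟨sT L x y, ?_, ?_⟩
    · rw [List.mem_toFinset, List.mem_map]
      exact ⟨(x, y), mem_repList hxL hyx h0, rfl⟩
    · unfold d4Orbit sT
      simp only [Finset.mem_insert, Finset.mem_singleton, Prod.neg_mk, neg_neg, Prod.ext_iff]
      rcases hx with hx | hx <;> rcases hy with hy | hy <;> simp [hx, hy]
  · refine ⟨sT L y x, ?_, ?_⟩
    · rw [List.mem_toFinset, List.mem_map]
      exact ⟨(y, x), mem_repList hyL hxy (fun h => h0 ⟨h.2, h.1⟩), rfl⟩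
    · unfold d4Orbit sT
      simp only [Finset.mem_insert, Finset.mem_singleton, Prod.neg_mk, neg_neg, Prod.ext_iff]
      rcases hx with hx | hx <;> rcases hy with hy | hy <;> simp [hx, hy]

/-- ★ HOLE₂(.75) from the quarter-table check of `repList L` alone (coverage discharged for every `L`). [folklore] -/
theorem twoHoleGap_of_checkRepsQ_repList (L : ℕ) [NeZero L] (h : checkRepsQ L (repList L) = true) :
    TwoHoleGap L (3 / 4 * eps1 L) :=
  twoHoleGap_of_checkRepsQ L (repList L) h (cover_repList L)

end Hole2

end Summit.HubbardSuperconductivity.HubbardSuperconductivity.Theorems.AnisotropyChord.Transfer.Fibre3
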